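import Literature.NumberTheory.EllipticCurves.Fouquet2025.CongruenceTransportAnyReduction
import Literature.NumberTheory.EllipticCurves.Sakamoto2024.KuriharaStructureAtThree
import HarnessLib

/-!
# Fouquet 2025 (Tunisian J. Math. 7), Thm 4.1 (1) ⇒ (2) with the mechanism of the proof of Cor. 4.3 — congruence transport from a good-ordinary elliptic SEED `G` whose assertion (1) is supplied AS A HYPOTHESIS (the integral cyclotomic main identity `char_Λ X(G/ℚ_∞) = (L_p(G,T))`, whatever its provenance), read on elliptic motivic points at `p ≥ 5`: (A′) the `p`-part of BSD in analytic rank `0` for a target of ANY reduction type, (B′) the main identity for a good-ORDINARY target; plus PROVED bridges: Skinner–Urban ⇒ seed identity (so the sibling facts (A)/(B) are corollaries), and Kato's integral divisibility + a UNIT `p`-adic `L`-function ⇒ seed identity (the unit-special-value seed of the paper's §4.2, from refereed inputs)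

Topic `NumberTheory/EllipticCurves`, sub-directory `Fouquet2025` (namespace = path). Written by the
typer seat `bsd-littype-07` (gen 2) of the cross-ladder literature-typing layer (D-0088(4); cell
`run/shared/lean/pub/bsd-littype/`). D-0064: one file for the source section §4.1 read through the
proof of Cor. 4.3 (the SEED MECHANISM). TWO named facts (`def … : Prop`, D-0014; nothing asserted,
no `_holds`: Fouquet's Taylor–Wiles–Kisin patching §3–§4, the zeta morphism of Thm 2.10 and Kato
§17.13 are not in Mathlib or the tree) and FOUR proved theorems. No `sorry`, no new definition, no
instance, no notation. The hypothesis shape "cyclotomic main identity for `(E, p, f)`" is the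
EXISTING predicate `Sakamoto2024.CyclotomicMainIdentityAt E p f` (file
`Sakamoto2024/KuriharaStructureAtThree.lean`; = bsd.S21 clause-3 shape of `PAdicBSD.lean`), reused,
not restated (typer lint rule).

RELATION TO THE TREE (why this file exists). The sibling `CongruenceTransportAnyReduction.lean`
(p455826; facts (A) `padicValRat_bsd_rank_zero_of_ordinaryCongruence_anyReduction`, (B)
`charIdeal_eq_padicLFunction_of_ordinaryCongruence`) and `OrdinaryCongruenceRankZeroBSD{,Sigma,
Nakamura}.lean` HARD-WIRE the provenance of assertion (1) of Thm 4.1 at the seed: the seed `G` must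
satisfy the hypotheses of Skinner–Urban's Thm 3.6.9 (bsd.S21), in particular carry a prime
`ℓ ∥ N_G` with `ρ̄` ramified at `ℓ`. Print does not: Thm 4.1 (1) is "there exists a motivic point
`λ` such that `z(λ)_Iw : Δ_{O_Iw}(T_{λ,Iw}) ≅ O_Iw`", of ANY provenance, and the paper's own
numerical examples (§4.2) supply it by a seed whose special value is a `p`-adic unit ("The elliptic
curve `E′` has analytic rank `0` and it is easy to check that the special value `L(E′,1)/Ω_E` is a
`5`-adic unit (for instance, the Kolyvagin class `κ(61 × 311)` is a `5`-adic unit)", p0030 L9–L11),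
through hypothesis 1 of Cor. 4.3 ("Kato's class `z(f)_Iw` generates `H¹_et(ℤ[1/p], T(f)_Iw)`",
p0025 L53) and the first half of its proof (p0026 L20–L31, quoted below), which PRINTS the
implication "hypothesis 1 at `f` + Kato's divisibility ⇒ assertion (1) of Thm 4.1 at `λ_f`". The
facts (A′)/(B′) below therefore take assertion (1) at the seed in the ONE currency the tree has for
it at a good-ordinary prime — Kato's Conj. 17.6 for `T_pG` integrally, i.e. the cyclotomic main
identity `char_Λ X(G/ℚ_∞) = (L_p(G,T))` in `Λ = ℤ_p⟦T⟧`, which Kato's §17.13 identity of lengths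
(an EQUALITY at every height-one prime, printed as "Hence Thm. 17.4 (resp. Conj. 17.6) becomes a
consequence of Thm. 12.5 (resp. Conj. 12.10)", p. 280, and read here in the direction
17.6 ⇒ 12.10 exactly as the sibling's reading (α) does after invoking S–U) turns into Conj. 12.10 for
`T_pG`, which is (example (iii) p0005, Conj. 2.7 p0013) assertion (1) at `λ_G`. Everything
downstream ((β) Thm 4.1 (1) ⇒ (2); (γ) Thm 1.7 (2) + §2.2 descent to BSD_p in rank `0`; (δ) Kato
§17.13 at the target for (B′)) is the sibling's referee-read chain VERBATIM. Consequences proved here: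
* `cyclotomicMainIdentityAt_of_skinnerUrban`: bsd.S21 (`skinner_urban_main_conjecture`) supplies the
  seed identity — so (A′) ∧ S21 ⇒ (A) (`anyReduction_of_seedMainIdentity`): the sibling fact is a
  COROLLARY of the one below, and (A′) is not a restatement of (A) (its seed hypothesis is strictly
  weaker: no Steinberg prime, no irreducibility-driven S–U machinery — any proof of the identity);
* `cyclotomicMainIdentityAt_of_katoDivisibility_of_norm_constantCoeff_eq_one`: bsd.S20 clause 3
  (`kato_divisibility`, Kato Thm 17.4 (3), REFEREED) at a good-ordinary `p ≠ 2` with `ρ_{G,p^∞}` onto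
  gives `L_p(G,T) = ι g` with `g ∈ char_Λ X`; if the constant term `L_p(G,0) = (1 − α⁻¹)² L(G,1)/Ω⁺`
  is a `p`-adic unit then `g ∈ Λˣ`, so `char_Λ X = Λ = (g)`: the identity holds for `G` — this is the
  unit-special-value seed of §4.2 realised from refereed inputs for good-ORDINARY seeds (the paper's
  `E′` of §4.2.2 is additive at `5`, where the tree has no `p`-adic `L`-function: that instance is NOT
  covered; the principle is). Hence the turnkey road `padicValRat_bsd_rank_zero_of_congruence_of_unitSeed`:
  (A′) + S20 ⇒ BSD_p in rank `0` for every target `W` (any reduction at `p ≥ 5`, Ass. 2.9, Ass. 3.4)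
  congruent mod `p` to a good-ordinary `G` with `ρ_{G,p^∞}` onto and `‖L_p(G,0)‖ = 1` — NO ramified
  Steinberg prime on either curve (OPEN-QUESTIONS-07 F3 in hypothesis shape; cell `bsd-potss` K8-t′
  partner supply at `p = 5`; `pub-bsdres` "no Steinberg prime" tier).

## The printed statements (O. Fouquet, Tunisian J. Math. 7 (2025) 791–829 = arXiv:2501.07105v1;
## page = arXiv page of the seat's materialisation, [corpus:paper-arxiv-2501.07105 pNNNN Lnn])

* **Thm 4.1** (p0024 L47–p0025 L9): "Assume that `ρ̄` satisfies 2.9 and 3.4. Then the isomorphism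
  (2.4.2) `z_Σ : Δ_Σ(T_Σ) ⊗ Q(T^Σ_𝔪ρ̄) ≅ Q(T^Σ_𝔪ρ̄)` of proposition 2.12 induces an inclusion
  `z_Σ : Δ_Σ(T_Σ)⁻¹ ↪ T^Σ_𝔪ρ̄`. In particular, the following assertions are equivalent. 1. There
  exists a motivic point `λ ∈ Spec^mot T^Σ_𝔪ρ̄` such that `z(λ)_Iw : Δ_{O_Iw}(T_{λ,Iw}) ≅ O_Iw`.
  2. For all motivic point `λ ∈ Spec^mot T^Σ_𝔪ρ̄`, `z(λ)_Iw : Δ_{O_Iw}(T_{λ,Iw}) ≅ O_Iw`. 3. […]"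
  (= Thm 1.7, p0007 L16–L27, whose (2) adds: "If in addition `L(f,χ,r) ≠ 0`, then conj[.] 1.1 for
  `W(λ)` at `p` holds (the Tamagawa Number Conj[.] is true for the motive `W(f)(r)` at `p`)").
* **Cor. 4.3, hypothesis 1** (p0025 L47–L53): "Under the hypotheses of theorem 4.1, let `λ, λ′` be two
  motivic points attached to two eigencuspforms `f ∈ S_k(Γ₁(N))` and `g ∈ S_{k′}(Γ₁(N′))`. Assume
  that the following holds. 1. Kato's class `z(f)_Iw` generates `H¹_et(ℤ[1/p], T(f)_Iw)`. […]"
* **Proof of Cor. 4.3, first half** (p0026 L20–L31): "In addition to our other assumptions, suppose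
  first that `ρ_f|G_ℚₚ` has no `G_ℚₚ`-stable quotient isomorphic to `χχ_cyc⁻¹` for `χ` a finite
  order character of `Γ`. Then [29, Theorem 12.5] yields a divisibility
  `char_{O_Iw} H²_et(ℤ[1/p], T(f)_Iw) ∣ char_{O_Iw} H¹_et(ℤ[1/p], T(f)_Iw)/O_Iw·z(f)_Iw` (4.1.2). As
  `z(f)_Iw` is by assumption a basis of `H¹_et(ℤ[1/p], T(f)_Iw)`, then the previous divisibility is
  an equality and so the zeta morphism yields an isomorphism `z(f)_Iw : Δ_{O_Iw}(f) ≅ O_Iw`." (The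
  second half, p0027 L9 ff., relaxes the supplementary assumption using [16, Prop. 3.14] =
  Fouquet–Wan arXiv:2107.13726, a PREPRINT; it is not used by anything below: a good-ordinary
  elliptic seed is potentially good at `p`.) p0025 L43–L46: "the full strength of theorem 4.1 is
  used only once in the proof: to ensure that the Iwasawa Main Conj[.] is true for the second
  eigencuspform `g`."
* **§4.2.2** (p0029 L58–p0030 L16; the paper's own use of the mechanism at `p = 5`): target
  `E : y² = x³ − 1825x + 306625`, `N = 2²·5²·23`, additive at `5`, "`ρ̄_E|G_ℚₚ` is absolutely
  irreducible and `ρ̄_E` is surjective"; "The Artin conductor of `ρ̄_E` is prime to `ℓ = 23`"; seed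
  `E′ : y² = x³ − x² − 33x + 62` of conductor `2²·5²`; "`ℓ ≢ ±1 mod 5`. So `ρ̄` and `T^Σ_𝔪ρ̄` satisfy
  assumption (2) of 3.4. It follows that `ρ_E` and `ρ_{E′}` satisfy the hypotheses of corollary 4.3.
  We conclude that the Iwasawa Main Conj[.] is true for `E` […]" — note `2 ∈ Σ(ρ̄)` (additive at
  `2`, `p = 5`): Ass. 3.4 ("if `ℓ ∤ p` belongs to `Σ ∖ Σ(ρ̄)` then it is odd and …", p0022 L43 =
  p0007 L17) constrains the primes where `ρ̄` is UNRAMIFIED only, as the tree's binders read it.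
* Ass. 2.9, §2.4.1 (motivic points), Ass. 3.4, Thm 1.7 (2), §2.2 (the printed descent to BSD_p in
  rank `0`), Kato Conj. 12.10 / 17.6 / §17.13: quoted in the sibling's module docstring (not repeated).

## The reading (what (A′)/(B′) transcribe; WEAKER than print in every binder, never stronger)

(α′) THE SEED. `G/ℚ` globally minimal, good ordinary at `p ≥ 5` (`p ∤ a_p(G)`), `G[p]` irreducible,
`ρ_{G,p^n}` onto for all `n` (supplies Kato's (12.5.2) for `G`, needed by §17.13 at the height-one
primes `𝔭 ∋ p`), a newform `g` of `G`, and THE HYPOTHESIS `Sakamoto2024.CyclotomicMainIdentityAt G p g`: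
for every cyclotomic `κ`, generator `γ` matching the variable and every dual Selmer datum `S`,
`X = S.X` is `Λ`-torsion and `char_Λ X = (u)` with `ι u = L_p(g, α_G)` — Kato's Conj. 17.6 for
`T_pG` at every height-one `𝔭` (the `Ω⁺_g`- and Néron-normalised `p`-adic `L`-functions generate the
same ideal since `G[p]` is irreducible: Greenberg–Vatsal 2000 (3.3), as in bsd.S21's docstring); by
the §17.13 IDENTITY (good ordinary, `p ≠ 2`, (12.5.2)) this is Conj. 12.10 for `T_pG`, i.e.
(example (iii), Conj. 2.7) `z(λ_G)_Iw : Δ_{O_Iw}(T_{λ_G,Iw}) ≅ O_Iw` — assertion (1) of Thm 4.1.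
(β) Thm 4.1 (1) ⇒ (2) on `ρ̄ = W[p] ≅ G[p]` (2.9 (1) ⟸ `ρ̄_{W,p}` onto; 2.9 (2) ⟺ the `ΨSq_p`
clause; 3.4 ⟸ `Assumption34TateAt p W`; `Σ =` primes of `p N_W`, `U^(p)` as in the sibling; the
congruence of traces off `p N_W N_G` and "every bad prime `q ≠ p` of `G` divides `N_W`" make `f_W`
and `g` motivic points of `T^Σ_𝔪ρ̄`, §2.4.1). (γ) For (A′): Thm 1.7 (2) second sentence + §2.2 ⇒
`v_p(L(W,1)/Ω_W) = v_p(#Ш(W)·∏c_ℓ/#W(ℚ)_tors²)` (print shape of bsd.S30). (δ) For (B′): Kato §17.13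
at the good-ordinary target `W` (with `ρ_{W,p^∞}` onto for (12.5.2)) ⇒ the identity for `W`, stated
as `Sakamoto2024.CyclotomicMainIdentityAt W p f`. All of (β)(γ)(δ) = the sibling's chain verbatim.

HONEST FRAMING / WHAT IS NOT CLAIMED. Nothing at `p ≤ 3`; no seed other than a good-ORDINARY elliptic
`G` (for a supersingular or additive seed the tree has no carrier for assertion (1): no pinned
`𝐇²`/`Z(f,T)`; in particular the literal §4.2.2 instance — `E′` additive at `5` — is NOT an instance
of (A′)); no statement that a unit `L`-VALUE alone gives hypothesis 1 of Cor. 4.3 (the proved bridge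
uses a unit `p`-adic `L`-FUNCTION through Kato 17.4 (3), which is stronger input and refereed); no
target with `ρ̄|G_ℚₚ` irreducible can have a good-ordinary congruent seed (`ρ̄_G|G_ℚₚ` is
reducible), so (A′) is vacuous on good-supersingular targets — harmless; Cor. 4.2 / 4.3's own
conclusions (`𝐇²` non-trivial, no pseudo-null submodules) are NOT typed (no pinned `𝐇²`). Net debt
+2 by design (typing layer); the two facts are XL (patching + `p`-adic Langlands inputs).
-- TODO(general form): seeds whose level is not supported on the primes of `p·N_W` (enlarged `Σ`
-- with Ass. 3.4 at the extra primes, cf. the sibling `OrdinaryCongruenceRankZeroBSDSigma`; the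
-- paper's §4.2.1 seed has level `1640 ⊋ 40`); non-elliptic, higher-weight or non-ordinary seeds
-- (assertion (1) in its printed `Δ`/`z_Iw` currency); hypothesis 1 of Cor. 4.3 from a unit special
-- VALUE (the paper's examples) rather than from a unit `p`-adic `L`-function.

## References
* [Fouquet2025EquivariantTNC] O. Fouquet, Tunisian J. Math. 7 (2025) 791–829 = arXiv:2501.07105:
  Thm 4.1 (pp. 24–25), Cor. 4.3 and its proof (pp. 25–27), §4.2.2 (pp. 29–30), Thm 1.7 (p. 7),
  Ass. 2.9, §2.4.1 (p. 15), Ass. 3.4 (pp. 22–23), §2.2 (p. 12), example (iii) (p. 5), Conj. 2.7 (p. 13).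
* [Kato2004Asterisque] K. Kato, Astérisque 295 (2004): Thm 12.5 (pp. 221–222), Conj. 12.10 (p. 224),
  Thm 17.4 (p. 273), Conj. 17.6 (p. 274), §17.13 (pp. 279–280).
* [SkinnerUrban2014] Thm 3.6.9 (p. 45) (tree: bsd.S21). [GreenbergVatsal2000] §3 (3.3).
* Tree: `Fouquet2025/CongruenceTransportAnyReduction.lean` (facts (A)/(B), `Assumption34TateAt`),
  `Sakamoto2024/KuriharaStructureAtThree.lean` (`CyclotomicMainIdentityAt`), `PAdicBSD.lean`
  (bsd.S20 `kato_divisibility`, bsd.S21 `skinner_urban_main_conjecture`), `CuspFormLFunction.lean`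
  (`exists_isNewformOf`, modularity as a named fact).
-/

noncomputable section

open scoped Classical MatrixGroups ModularForm

namespace Literature.NumberTheory.EllipticCurves.Fouquet2025

open WeierstrassCurve CongruenceSubgroup Literature.NumberTheory.EllipticCurves.ModularForms

/-! ## (A′) Thm 4.1 (1) ⇒ (2) with Thm 1.7 (2), assertion (1) supplied at a good-ordinary seed as
## its cyclotomic main identity: the `p`-part of BSD in analytic rank `0`, target of ANY reduction -/

/-- **Fouquet 2025, Thm 4.1 (1) ⇒ (2) and Thm 1.7 (2) read on elliptic motivic points, with
assertion (1) at the SEED supplied as a hypothesis — the `p`-part of the Birch–Swinnerton-Dyer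
formula in analytic rank `0` for an elliptic curve `W/ℚ` of ARBITRARY reduction type at `p ≥ 5`,
transported from a congruent good-ordinary elliptic curve `G` for which the integral cyclotomic
main identity `char_Λ X(G/ℚ_∞) = (L_p(G,T))` holds (of whatever provenance); ONE composite reading
(module docstring (α′)(β)(γ)), nothing asserted, no `_holds` (size XL).**

Binders in order: `W`, `G` globally minimal elliptic curves over `ℚ`, a prime `p ≥ 5`. ON
`ρ̄ = W[p]`: Ass. 2.9 (1) ⟸ `ρ̄_{W,p}` onto `GL₂(𝔽_p)`; Ass. 2.9 (2) ⟺ "the `p`-division polynomial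
`ΨSq_p` of `W` has no root in `ℚ_p`" (sibling docstring); Ass. 3.4 ⟸ `Assumption34TateAt p W`. ON
THE SEED: `G` good at `p` with `p ∤ a_p(G)`, `G[p]` irreducible, `ρ_{G,p^n}` onto for all `n`
(Kato's (12.5.2) for §17.13 at `𝔭 ∋ p`), a newform `g` of `G` (`IsNewformOf G g`) and
`Sakamoto2024.CyclotomicMainIdentityAt G p g` — by Kato §17.13 (identity of lengths at every
height-one prime, good ordinary, `p ≠ 2`) this is Kato's Conj. 12.10 for `T_pG`, i.e. assertion (1)
of Thm 4.1 at `λ_G` (example (iii), Conj. 2.7). THE CONGRUENCE: `a_ℓ(W) ≡ a_ℓ(G) (mod p)` off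
`p N_W N_G` and every bad prime `q ≠ p` of `G` divides `N_W` (so `W[p] ≅ G[p]` and `f_W`, `g` are
motivic points of `T^Σ_𝔪ρ̄`, `Σ =` primes of `p N_W`). THE TARGET: `L(W,1) ≠ 0`, `Ш(W)` finite
(kept as a binder; WEAKER than print). CONCLUSION (Thm 1.7 (2) + §2.2, p. 12):
`v_p(L(W,1)/Ω_W) = v_p(#Ш(W)·∏_ℓ c_ℓ/#W(ℚ)_tors²)` in the print shape of bsd.S30 (`Ω_W` the Néron
period of the minimal model; the torsion term is a `p`-adic unit as `W[p]` is irreducible).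
Transcription = the sibling's. WEAKER THAN PRINT in every binder (surjectivity for "contains
`SL₂(𝔽_p)`", a good-ordinary elliptic seed with its identity in Conj. 17.6 form for "a motivic
point with (1)", strict `Σ`, `p ≥ 5`, `Finite W.sha`); never stronger. The sibling fact (A) is the
special case where the seed identity comes from Skinner–Urban (`anyReduction_of_seedMainIdentity`).
[cite: Fouquet2025EquivariantTNC, Thm 4.1 (1)⇒(2) (pp. 24–25), Thm 1.7 (2) (p. 7), proof of Cor. 4.3 first half (p. 26), §4.2.2 (pp. 29–30), Ass. 2.9 and §2.4.1 (p. 15), Ass. 3.4 (pp. 22–23), §2.2 (p. 12), example (iii) (p. 5), Conj. 2.7 (p. 13)]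
[cite: Kato2004Asterisque, §17.13 (pp. 279–280), Conj. 12.10 (p. 224), Conj. 17.6 (p. 274), (12.5.2) (p. 222)] [cite: GreenbergVatsal2000, §3 (3.3)] -/
def padicValRat_bsd_rank_zero_of_congruence_of_seedMainIdentity : Prop :=
  ∀ (W G : WeierstrassCurve ℚ) [W.IsElliptic] [W.IsGloballyMinimal] [G.IsElliptic] [G.IsGloballyMinimal]
    (p : ℕ) [Fact p.Prime], 5 ≤ p →
    -- Ass. 2.9 (1): `ρ̄_{W,p}` onto `GL₂(𝔽_p)`
    W.HasSurjectiveModNGaloisRep p →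
    -- Ass. 2.9 (2): the `p`-division polynomial of `W` has no root in `ℚ_p`
    (∀ x : ℚ_[p], ((W.baseChange ℚ_[p]).ΨSq (p : ℤ)).eval x ≠ 0) →
    -- Ass. 3.4 on the Tate primes of `W` (Kummer clause in Tate form)
    Assumption34TateAt p W →
    -- the seed `λ_G`: good ordinary at `p`, `G[p]` irreducible, `ρ_{G,p^∞}` onto, a newform `g`,
    -- and ITS integral cyclotomic main identity (assertion (1) of Thm 4.1 in Conj. 17.6 form)
    G.HasGoodReductionAtPrime p → ¬ (p : ℤ) ∣ G.frobeniusTrace p →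
    G.HasIrreducibleModPGaloisRep p →
    (∀ n : ℕ, G.HasSurjectiveModNGaloisRep (p ^ n : ℕ)) →
    ∀ {M : ℕ} [NeZero M] (g : CuspForm (Gamma0 M) 2), IsNewformOf G g →
    Sakamoto2024.CyclotomicMainIdentityAt G p g →
    -- `a_ℓ(W) ≡ a_ℓ(G) (mod p)` off `p N_W N_G`, and every bad prime `≠ p` of `G` divides `N_W`
    (∀ ℓ : ℕ, ℓ.Prime → ¬ (ℓ ∣ p * W.conductorNorm ℤ * G.conductorNorm ℤ) →
      ((W.LFunction ℓ : ℤ) : ZMod p) = ((G.LFunction ℓ : ℤ) : ZMod p)) →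
    (∀ q : ℕ, q.Prime → q ≠ p → (q : ℤ) ∣ G.conductorNorm ℤ → (q : ℤ) ∣ W.conductorNorm ℤ) →
    -- analytic rank 0, `Ш(W)` finite
    W.entireLFunction 1 ≠ 0 → Finite W.sha →
    ∃ q : ℚ, W.entireLFunction 1 / (W.realPeriodRat : ℂ) = (q : ℂ) ∧
      padicValRat p q = (padicValNat p W.shaOrder : ℤ) + padicValNat p W.tamagawaProduct -
        2 * padicValNat p W.torsionOrder

/-! ## (B′) Thm 4.1 (1) ⇒ (2) with Kato §17.13 at both ends: the main identity transported from a
## good-ordinary seed to a good-ORDINARY target at `p ≥ 5` -/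

/-- **Fouquet 2025, Thm 4.1 (1) ⇒ (2) read on elliptic motivic points with a good-ORDINARY target,
assertion (1) at the SEED supplied as a hypothesis — the integral cyclotomic main identity
`char_Λ X(W/ℚ_∞) = (L_p(W,T))` for an elliptic curve `W/ℚ` good ordinary at `p ≥ 5`, in ANY rank,
transported from a congruent good-ordinary `G` for which the same identity holds (of whatever
provenance); ONE composite reading (module docstring (α′)(β)(δ)), nothing asserted, no `_holds`
(size XL).**

Hypotheses ON `W`: good reduction at `p`, `p ∤ a_p(W)`; `ρ̄_{W,p}` onto and `ρ_{W,p^n}` onto for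
all `n` (Kato's (12.5.2) for `W`, needed by §17.13 at `𝔭 ∋ p`); Ass. 2.9 (2) as the `ΨSq_p`
clause; `Assumption34TateAt p W`. ON THE SEED and THE CONGRUENCE: as in (A′). CHAIN: (α′) the
hypothesis `Sakamoto2024.CyclotomicMainIdentityAt G p g` is, by Kato §17.13, Conj. 12.10 for `T_pG`
= assertion (1) at `λ_G`; (β) Thm 4.1 (1) ⇒ (2): Conj. 12.10 for `T_pW`; (δ) Kato §17.13 for `f_W`
(good ordinary, `p ≠ 2`, (12.5.2)) turns it into Conj. 17.6 for `T_pW` at every height-one prime,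
i.e. the identity for `W`, stated as `Sakamoto2024.CyclotomicMainIdentityAt W p f` for a newform `f`
of `W` (= bsd.S21 clause 3 / the sibling fact (B)'s conclusion; same objects and normalisations,
the period ratio being a `p`-adic unit as `W[p]` is irreducible). WEAKER THAN PRINT in every binder;
never stronger. NOT CLAIMED: targets not good ordinary at `p` (no `p`-adic `L`-function object —
see (A′) for the rank-0 descent), `p ≤ 3`, non-elliptic or non-ordinary seeds. NO Skinner–Urban
hypothesis (ramified Steinberg prime) on either curve.
[cite: Fouquet2025EquivariantTNC, Thm 4.1 (1)⇒(2) (pp. 24–25), proof of Cor. 4.3 first half (p. 26), example (iii) (p. 5), Conj. 2.7 (p. 13), Ass. 2.9, §2.4.1 (p. 15), Ass. 3.4 (pp. 22–23)]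
[cite: Kato2004Asterisque, §17.13 (pp. 279–280), Conj. 12.10 (p. 224), Conj. 17.6 (p. 274), Thm 17.4 (1) (p. 273), (12.5.2) (p. 222)] [cite: GreenbergVatsal2000, §3 (3.3)] -/
def charIdeal_eq_padicLFunction_of_congruence_of_seedMainIdentity : Prop :=
  ∀ (W G : WeierstrassCurve ℚ) [W.IsElliptic] [W.IsGloballyMinimal] [G.IsElliptic] [G.IsGloballyMinimal]
    (p : ℕ) [Fact p.Prime], 5 ≤ p →
    -- the target `λ_W`: good ordinary at `p`, big image, Ass. 2.9 (2), Ass. 3.4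
    W.HasGoodReductionAtPrime p → ¬ (p : ℤ) ∣ W.frobeniusTrace p →
    W.HasSurjectiveModNGaloisRep p → (∀ n : ℕ, W.HasSurjectiveModNGaloisRep (p ^ n : ℕ)) →
    (∀ x : ℚ_[p], ((W.baseChange ℚ_[p]).ΨSq (p : ℤ)).eval x ≠ 0) →
    Assumption34TateAt p W →
    -- the seed `λ_G` with its identity
    G.HasGoodReductionAtPrime p → ¬ (p : ℤ) ∣ G.frobeniusTrace p →
    G.HasIrreducibleModPGaloisRep p →
    (∀ n : ℕ, G.HasSurjectiveModNGaloisRep (p ^ n : ℕ)) →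
    ∀ {M : ℕ} [NeZero M] (g : CuspForm (Gamma0 M) 2), IsNewformOf G g →
    Sakamoto2024.CyclotomicMainIdentityAt G p g →
    -- the congruence and level compatibility
    (∀ ℓ : ℕ, ℓ.Prime → ¬ (ℓ ∣ p * W.conductorNorm ℤ * G.conductorNorm ℤ) →
      ((W.LFunction ℓ : ℤ) : ZMod p) = ((G.LFunction ℓ : ℤ) : ZMod p)) →
    (∀ q : ℕ, q.Prime → q ≠ p → (q : ℤ) ∣ G.conductorNorm ℤ → (q : ℤ) ∣ W.conductorNorm ℤ) →
    -- conclusion: the identity for `W` (bsd.S21 clause-3 shape) for every newform `f` of `W`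
    ∀ {N : ℕ} [NeZero N] (f : CuspForm (Gamma0 N) 2), IsNewformOf W f →
      Sakamoto2024.CyclotomicMainIdentityAt W p f

/-! ## Proved bridges: the seed identity from Skinner–Urban (so the sibling facts are corollaries)
## and from Kato's integral divisibility with a unit `p`-adic `L`-function -/

/-- **Skinner–Urban supplies the seed identity.** For `G` good ordinary at `p ≥ 3` with `G[p]`
irreducible, a prime `ℓ ∥ N_G` (`ℓ ≠ p`) with `ρ̄` ramified and `ρ_{G,p^n}` onto for all `n`, the
tree's bsd.S21 (the Skinner–Urban fact of `PAdicBSD.lean`; Skinner–Urban 2014 Thm 3.6.9, clause 3) gives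
`Sakamoto2024.CyclotomicMainIdentityAt G p g` for every newform `g` of `G` (the two shapes coincide
clause by clause). [cite: SkinnerUrban2014, Thm 3.6.9 (p. 45)] -/
theorem cyclotomicMainIdentityAt_of_skinnerUrban (G : WeierstrassCurve ℚ) [G.IsElliptic]
    [G.IsGloballyMinimal] (p : ℕ) [Fact p.Prime]
    (hSU : ∀ (κ : ZpExtension ℚ p) (γ : Field.absoluteGaloisGroup ℚ) (N : ℕ) [NeZero N]
      (g : CuspForm (Gamma0 N) 2), skinner_urban_main_conjecture G p (κ := κ) (γ := γ) (f := g))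
    (hp : 3 ≤ p) (hgood : G.HasGoodReductionAtPrime p) (hord : ¬ (p : ℤ) ∣ G.frobeniusTrace p)
    (hirr : G.HasIrreducibleModPGaloisRep p)
    (haux : ∃ ℓ : ℕ, ∃ _ : Fact ℓ.Prime, ℓ ≠ p ∧ G.HasMultiplicativeReductionAtPrime ℓ ∧
      ¬ p ∣ padicValInt ℓ G.minimalDiscriminantInt)
    (hbig : ∀ n : ℕ, G.HasSurjectiveModNGaloisRep (p ^ n : ℕ))
    {N : ℕ} [NeZero N] (g : CuspForm (Gamma0 N) 2) (hg : IsNewformOf G g) :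
    Sakamoto2024.CyclotomicMainIdentityAt G p g := by
  intro κ γ hκ hγ hγ' S
  obtain ⟨htors, -, h3⟩ := hSU κ γ N g hp hgood hord hirr haux hκ hγ hγ' hg S
  exact ⟨htors, h3 hbig⟩

/-- **(A′) ∧ bsd.S21 ⇒ (A):** the sibling fact
`padicValRat_bsd_rank_zero_of_ordinaryCongruence_anyReduction` (seed = a Skinner–Urban curve) follows
from (A′) once Skinner–Urban's theorem (bsd.S21) and modularity (`exists_isNewformOf`, to name a
newform of the seed) are granted — the seed's identity is `cyclotomicMainIdentityAt_of_skinnerUrban`.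
So (A) is a corollary of (A′), not an independent hypothesis. [cite: Fouquet2025EquivariantTNC, Thm 4.1 (1)⇒(2) (pp. 24–25)] [cite: SkinnerUrban2014, Thm 3.6.9 (p. 45)] -/
theorem anyReduction_of_seedMainIdentity
    (hA : padicValRat_bsd_rank_zero_of_congruence_of_seedMainIdentity)
    (hSU : ∀ (G : WeierstrassCurve ℚ) [G.IsElliptic] [G.IsGloballyMinimal] (p : ℕ) [Fact p.Prime]
      (κ : ZpExtension ℚ p) (γ : Field.absoluteGaloisGroup ℚ) (N : ℕ) [NeZero N]
      (g : CuspForm (Gamma0 N) 2), skinner_urban_main_conjecture G p (κ := κ) (γ := γ) (f := g))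
    (hmod : exists_isNewformOf) :
    padicValRat_bsd_rank_zero_of_ordinaryCongruence_anyReduction := by
  intro W G _ _ _ _ p _ hp hsurj hΨ h34 hGgood hGord hGirr hGaux hGbig hcong hlev hL hsha
  haveI : NeZero (G.conductorNorm ℤ) := ⟨(G.conductorNorm_pos_holds).ne'⟩
  obtain ⟨g, hg⟩ := hmod G
  have hid : Sakamoto2024.CyclotomicMainIdentityAt G p g :=
    cyclotomicMainIdentityAt_of_skinnerUrban G p (hSU G p) (by omega) hGgood hGord hGirr hGaux
      hGbig g hg
  exact hA W G p hp hsurj hΨ h34 hGgood hGord hGirr hGbig g hg hid hcong hlev hL hsha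

/-- **(B′) ∧ bsd.S21 ⇒ (B):** likewise the sibling fact `charIdeal_eq_padicLFunction_of_ordinaryCongruence`
follows from (B′), Skinner–Urban (bsd.S21) and modularity. [cite: Fouquet2025EquivariantTNC, Thm 4.1 (1)⇒(2) (pp. 24–25)] [cite: SkinnerUrban2014, Thm 3.6.9 (p. 45)] -/
theorem ordinaryCongruence_of_seedMainIdentity
    (hB : charIdeal_eq_padicLFunction_of_congruence_of_seedMainIdentity)
    (hSU : ∀ (G : WeierstrassCurve ℚ) [G.IsElliptic] [G.IsGloballyMinimal] (p : ℕ) [Fact p.Prime]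
      (κ : ZpExtension ℚ p) (γ : Field.absoluteGaloisGroup ℚ) (N : ℕ) [NeZero N]
      (g : CuspForm (Gamma0 N) 2), skinner_urban_main_conjecture G p (κ := κ) (γ := γ) (f := g))
    (hmod : exists_isNewformOf) :
    charIdeal_eq_padicLFunction_of_ordinaryCongruence := by
  intro W G _ _ _ _ p _ hp hWgood hWord hsurj hWbig hΨ h34 hGgood hGord hGirr hGaux hGbig hcong hlev
    κ γ hκ hγ hγ' N _ f hf D
  haveI : NeZero (G.conductorNorm ℤ) := ⟨(G.conductorNorm_pos_holds).ne'⟩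
  obtain ⟨g, hg⟩ := hmod G
  have hid : Sakamoto2024.CyclotomicMainIdentityAt G p g :=
    cyclotomicMainIdentityAt_of_skinnerUrban G p (hSU G p) (by omega) hGgood hGord hGirr hGaux
      hGbig g hg
  exact hB W G p hp hWgood hWord hsurj hWbig hΨ h34 hGgood hGord hGirr hGbig g hg hid hcong hlev f hf
    κ γ hκ hγ hγ' D

/-- **Kato's integral divisibility with a UNIT `p`-adic `L`-function gives the identity** (the
unit-special-value seed of Fouquet's §4.2, from refereed inputs, for a good-ordinary curve). Let `G`
be good ordinary at `p ≠ 2` with `ρ_{G,p^n}` onto for all `n`, and grant bsd.S20 `kato_divisibility`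
(Kato 2004 Thm 17.4) for `G`: clause 3 gives `u ∈ char_Λ X(G/ℚ_∞)` with `ι u = L_p(g, α_G)`. If the
constant term `L_p(g, α_G)(0)` (`= (1 − α_G⁻¹)² L(G,1)/Ω⁺_g`, MTT) has `p`-adic norm `1`, then
`u(0) ∈ ℤ_pˣ`, so `u ∈ Λˣ` (`PowerSeries.isUnit_iff_constantCoeff`), hence `char_Λ X = Λ = (u)` and
`X` is torsion (clause 1): `Sakamoto2024.CyclotomicMainIdentityAt G p g`. [cite: Kato2004Asterisque, Thm 17.4 (1)(3) (p. 273)] [cite: Fouquet2025EquivariantTNC, §4.2.2 (pp. 29–30) (the unit-special-value seed)] -/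
theorem cyclotomicMainIdentityAt_of_katoDivisibility_of_norm_constantCoeff_eq_one
    (G : WeierstrassCurve ℚ) [G.IsElliptic] [G.IsGloballyMinimal] (p : ℕ) [Fact p.Prime]
    (hKato : ∀ (κ : ZpExtension ℚ p) (γ : Field.absoluteGaloisGroup ℚ) (N : ℕ) [NeZero N]
      (g : CuspForm (Gamma0 N) 2), kato_divisibility G p (κ := κ) (γ := γ) (f := g))
    (hp : p ≠ 2) (hord : IsOrdinaryAt G p) (hbig : ∀ n : ℕ, G.HasSurjectiveModNGaloisRep (p ^ n : ℕ))
    {N : ℕ} [NeZero N] (g : CuspForm (Gamma0 N) 2) (hg : IsNewformOf G g)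
    (hunit : ‖PowerSeries.constantCoeff (padicLFunction g (unitRoot G p : ℚ_[p]))‖ = 1) :
    Sakamoto2024.CyclotomicMainIdentityAt G p g := by
  intro κ γ hκ hγ hγ' S
  obtain ⟨htors, -, h3⟩ := hKato κ γ N g hp hord hκ hγ hγ' hg S
  obtain ⟨u, hu, hιu⟩ := h3 hbig
  -- the constant coefficient of `u` is a `p`-adic unit
  have hcoeff : algebraMap ℤ_[p] ℚ_[p] (PowerSeries.constantCoeff u) =
      PowerSeries.constantCoeff (padicLFunction g (unitRoot G p : ℚ_[p])) := by
    rw [← hιu]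
    show _ = PowerSeries.constantCoeff (PowerSeries.map (algebraMap ℤ_[p] ℚ_[p]) u)
    simp only [← PowerSeries.coeff_zero_eq_constantCoeff_apply, PowerSeries.coeff_map]
  have hnorm : ‖PowerSeries.constantCoeff u‖ = 1 := by
    rw [PadicInt.norm_def]
    change ‖algebraMap ℤ_[p] ℚ_[p] (PowerSeries.constantCoeff u)‖ = 1
    rw [hcoeff, hunit]
  have hunitU : IsUnit u :=
    PowerSeries.isUnit_iff_constantCoeff.mpr (PadicInt.isUnit_iff.mpr hnorm)
  refine ⟨htors, u, hιu, ?_⟩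
  rw [Ideal.span_singleton_eq_top.mpr hunitU]
  exact Ideal.eq_top_of_isUnit_mem _ hu hunitU

/-- **The turnkey rank-0 road (A′) + bsd.S20 with a unit-`L_p` partner.** Granting (A′) and Kato's
theorem bsd.S20 for the partner: for a target `W` of ANY reduction type at `p ≥ 5` satisfying Ass.
2.9 (surjective `ρ̄_{W,p}`, `ΨSq_p` rootless over `ℚ_p`) and Ass. 3.4 (`Assumption34TateAt p W`),
congruent mod `p` off `p N_W N_G` to a good-ordinary `G` (bad primes `≠ p` of `G` dividing `N_W`)
with `G[p]` irreducible, `ρ_{G,p^n}` onto for all `n` and a newform `g` whose `p`-adic `L`-function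
has unit constant term, the `p`-part of BSD holds for `W` in analytic rank `0` (given `L(W,1) ≠ 0`,
`Ш(W)` finite). No ramified Steinberg prime is required on either curve.
[cite: Fouquet2025EquivariantTNC, Thm 4.1 (1)⇒(2) (pp. 24–25), proof of Cor. 4.3 first half (p. 26), §4.2.2 (pp. 29–30)] [cite: Kato2004Asterisque, Thm 17.4 (3) (p. 273)] -/
theorem padicValRat_bsd_rank_zero_of_congruence_of_unitSeed
    (hA : padicValRat_bsd_rank_zero_of_congruence_of_seedMainIdentity)
    (W G : WeierstrassCurve ℚ) [W.IsElliptic] [W.IsGloballyMinimal] [G.IsElliptic] [G.IsGloballyMinimal]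
    (p : ℕ) [Fact p.Prime] (hp : 5 ≤ p)
    (hKato : ∀ (κ : ZpExtension ℚ p) (γ : Field.absoluteGaloisGroup ℚ) (N : ℕ) [NeZero N]
      (g : CuspForm (Gamma0 N) 2), kato_divisibility G p (κ := κ) (γ := γ) (f := g))
    (hsurj : W.HasSurjectiveModNGaloisRep p)
    (hΨ : ∀ x : ℚ_[p], ((W.baseChange ℚ_[p]).ΨSq (p : ℤ)).eval x ≠ 0)
    (h34 : Assumption34TateAt p W)
    (hGgood : G.HasGoodReductionAtPrime p) (hGord : ¬ (p : ℤ) ∣ G.frobeniusTrace p)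
    (hGirr : G.HasIrreducibleModPGaloisRep p) (hGbig : ∀ n : ℕ, G.HasSurjectiveModNGaloisRep (p ^ n : ℕ))
    {M : ℕ} [NeZero M] (g : CuspForm (Gamma0 M) 2) (hg : IsNewformOf G g)
    (hunit : ‖PowerSeries.constantCoeff (padicLFunction g (unitRoot G p : ℚ_[p]))‖ = 1)
    (hcong : ∀ ℓ : ℕ, ℓ.Prime → ¬ (ℓ ∣ p * W.conductorNorm ℤ * G.conductorNorm ℤ) →
      ((W.LFunction ℓ : ℤ) : ZMod p) = ((G.LFunction ℓ : ℤ) : ZMod p))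
    (hlev : ∀ q : ℕ, q.Prime → q ≠ p → (q : ℤ) ∣ G.conductorNorm ℤ → (q : ℤ) ∣ W.conductorNorm ℤ)
    (hL : W.entireLFunction 1 ≠ 0) (hsha : Finite W.sha) :
    ∃ q : ℚ, W.entireLFunction 1 / (W.realPeriodRat : ℂ) = (q : ℂ) ∧
      padicValRat p q = (padicValNat p W.shaOrder : ℤ) + padicValNat p W.tamagawaProduct -
        2 * padicValNat p W.torsionOrder := by
  have hid : Sakamoto2024.CyclotomicMainIdentityAt G p g :=
    cyclotomicMainIdentityAt_of_katoDivisibility_of_norm_constantCoeff_eq_one G p hKato (by omega)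
      ⟨hGgood, hGord⟩ hGbig g hg hunit
  exact hA W G p hp hsurj hΨ h34 hGgood hGord hGirr hGbig g hg hid hcong hlev hL hsha

end Literature.NumberTheory.EllipticCurves.Fouquet2025

end

/-! ## ADDENDUM — PROVENANCE OF THM 2.10 INSIDE THM 4.1 (typer bsd-littype-07 gen 2, 2026-08-26; docstring only,
## no declaration changed; verbatim the dichotomy of the sibling `OrdinaryCongruenceRankZeroBSD.lean` ADDENDUM of seat
## bsd-potss-k8t-c2 g5)
Every named fact of this file transcribes Fouquet's Thm 4.1 (1) ⇒ (2) under his PRINTED hypotheses (Ass. 2.9, Ass. 3.4).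
Thm 4.1's input Thm 2.10 (the zeta morphism for `T_Σ`, p. 15) is attributed by Fouquet to «K. Nakamura and independently
P. Colmez and S. Wang». Nakamura's PUBLISHED theorem (Invent. Math. 234 (2023) Thm 1.1) carries the local hypothesis (4)
`ρ̄_p ≇ (1 ∗; 0 ε̄^{±1}) ⊗ χ`, ONE SIGN STRONGER than Ass. 2.9 (2), which coincides with the «générique» hypothesis of
Colmez–Wang, arXiv:2104.09200 — a PREPRINT. Here `ρ̄ = W[p] ≅ G[p]` with `G` a good-ORDINARY seed
(`ρ̄_p ≅ (ωδ⁻¹ ∗; 0 δ)`, `δ(Frob_p) ≡ a_p(G)`), so hypothesis (4) fails iff `a_p(G)² ≡ 1 (mod p)`: on such rows the chain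
behind these facts has a preprint input (Colmez–Wang) as far as the seats could determine — referee flag suffix
`@Fouquet-2.10-via-ColmezWang-PRE` —, while for `a_p(G)² ≢ 1 (mod p)` every input is refereed (Nakamura 2023; the
pattern of the sibling `padicValRat_bsd_rank_zero_of_ordinaryCongruence_nakamura`, whose extra binder is
`¬ (p : ℤ) ∣ a_p(G)² − 1`). Consumers who need a preprint-free chain add that binder on the seed. Nothing declared above
changed. [cite: Fouquet2025EquivariantTNC, Thm 2.10 (p. 15)] -/
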